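import Summits.BirchSwinnertonDyer.BirchSwinnertonDyer.Theorems.Rank2ObservatoryRank3RootNumber3Census
import Summits.BirchSwinnertonDyer.BirchSwinnertonDyer.Theorems.Rank2ObservatoryConductorCert3
import HarnessLib

/-!
# BSD rank ≥ 2 observatory (`b2b-bsdr2`): rank-3 census WITH THE CONDUCTOR DISCHARGED for the rows
# additive at `3` and tame at `2`

HONEST FRAMING: per-curve certified theorems and census instruments; no claim on BSD in rank ≥ 2.

Census leaf of `Rank2ObservatoryConductorCert3` (unit `b2b-bsdr2-cert-2`, gen 6).  The gen-5 leaf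
`Rank2ObservatoryRank3ConductorCensus` discharges `hN : conductorNorm ℤ = N` for the `5347` TAME rows
(no additive reduction at `2` or `3`) modulo the five named facts on conductor exponents.  Here the same
is done for the `1116` rows ADDITIVE AT `3` AND TAME AT `2`, re-using the `1550` root-number
certificates with the place `3` (`rank3RN3Certs`, `Rank2ObservatoryRank3RootNumber3Census`): for every
listed certificate that is tame at `2` on its row, the certified conductor `RNCert3.conductor`
(`2^{[2 ∣ Δ]} · 3^{f₃} · ∏ p^{1 or 2}`, `f₃` = Table II's `v(N)` column evaluated in the kernel) equals
the table's `N` — ONE kernel pass `condPosWalk3` over the `9487`-row table (the certificates' own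
checks are the kernel theorems of the chunks `Rank2ObservatoryRank3RN3Certs1–5`, not re-run).  Hence
`N_E = N` for these rows modulo the five conductor-exponent facts AND the Table II fact at `3`
(`WeierstrassCurve.conductorExponent_eq_tableConductorExponentThree`, hypothesis `h3`), and the census
headline `Rank3Row.rank3_lderiv_eq_zero_kernel_wmN3` with `hlow`, `hw`, `hmin`, `hN` ALL replaced
(by kernel certificates resp. named facts).  Count: `1116` of the `1550` listed rows are tame at `2`
(`rank3RN3Certs_tameCount`); conductor coverage of the census after this file: `5347 + 1116 = 6463`
of `9487` rows (the rest are additive at `2`).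

Cross-checks outside the proofs: the Table II `v(N)` column agrees with `v₃(N)` on all 3 064 705
curves of Cremona's database `N < 5·10⁵` and with PARI/GP `elllocalred` on the 923 952 of them additive
at `3` (job `j102193`); the certified conductor equals Cremona's `N` on all `1116` rows (generator
check).  References: Silverman *ATAEC* IV.10 [Silverman1994]; Rizzo 2003 [Rizzo2003]; Cremona 1997
[CremonaAlgorithms1997]; Gross 1991 [GrossLMS1991].
-/

set_option linter.dupNamespace false
set_option autoImplicit false

open WeierstrassCurve IsDedekindDomain Literature Literature.NumberTheory.EllipticCurves

namespace Summit.BirchSwinnertonDyer.BirchSwinnertonDyer.Rank2Observatory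

open RootNumber

/-- A row is CONDUCTOR CERTIFIED WITH THE PLACE `3` if some `RNCert3` checks on its integer model,
is tame at `2`, and certifies the table conductor `N`. [folklore] -/
def Rank3Row.ConductorCertified3 (r : Rank3Row) : Prop :=
  ∃ c : RNCert3, c.check r.intModel = true ∧ c.tame r.intModel = true ∧ c.conductor r.intModel = r.N

/-- **`N_E = N` for a row conductor-certified with the place `3`**, modulo the five named facts on
conductor exponents and the Table II conductor-exponent fact at `3`.
[cite: Silverman1994, IV.10.2 and IV.10.4] [cite: Rizzo2003, Table II (p. 4), column v(N)] -/
theorem Rank3Row.conductorNorm_eq_of_certified3 {r : Rank3Row} (h : r.ConductorCertified3)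
    (h0 : ∀ v : HeightOneSpectrum ℤ, conductorExponent_eq_zero_iff v r.curve)
    (h1 : ∀ v : HeightOneSpectrum ℤ, conductorExponent_eq_one_iff v r.curve)
    (h2 : ∀ v : HeightOneSpectrum ℤ, two_le_conductorExponent_iff v r.curve)
    (h5 : ∀ v : HeightOneSpectrum ℤ, conductorExponent_le_two_of_five_le_natGenerator r.curve v)
    (hf : ∀ v : HeightOneSpectrum ℤ, factorization_conductorNorm r.curve v)
    (h3 : r.curve.conductorExponent_eq_tableConductorExponentThree) :
    r.curve.conductorNorm ℤ = r.N := by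
  obtain ⟨c, hc, ht, hN⟩ := h
  rw [Rank3Row.curve_eq_baseChange] at h0 h1 h2 h5 hf h3 ⊢
  rw [conductorNorm_eq_conductor3 hc ht h0 h1 h2 h5 hf h3, hN]

/-- One-pass conductor walk over the table: for every listed pair `(i, c)` (indices increasing) whose
certificate is tame at `2` on row `i`, the certified conductor is the row's `N`. [folklore] -/
def condPosWalk3 : List Rank3Row → ℕ → List (ℕ × RNCert3) → Bool
  | _, _, [] => true
  | [], _, _ :: _ => false
  | r :: rs, n, (i, c) :: rest =>
      if i = n then (!(c.tame r.intModel) || (c.conductor r.intModel == r.N)) &&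
          condPosWalk3 rs (n + 1) rest
      else condPosWalk3 rs (n + 1) ((i, c) :: rest)

/-- What a passing conductor walk says about each listed pair. [folklore] -/
theorem cond_of_condPosWalk3 :
    ∀ (rows : List Rank3Row) (n : ℕ) (ps : List (ℕ × RNCert3)), condPosWalk3 rows n ps = true →
      ∀ (i : ℕ) (c : RNCert3), (i, c) ∈ ps →
        n ≤ i ∧ ∃ r : Rank3Row, rows[i - n]? = some r ∧
          (c.tame r.intModel = true → c.conductor r.intModel = r.N)
  | _, _, [], _, i, c, hm => by simp at hm
  | [], _, _ :: _, h, _, _, _ => by simp [condPosWalk3] at h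
  | r :: rs, n, (j, d) :: rest, h, i, c, hm => by
    by_cases hj : j = n
    · subst hj
      simp only [condPosWalk3, ↓reduceIte, Bool.and_eq_true, Bool.or_eq_true, Bool.not_eq_true',
        beq_iff_eq] at h
      rcases List.mem_cons.mp hm with he | hm'
      · obtain ⟨rfl, rfl⟩ := Prod.mk.inj he
        refine ⟨le_rfl, r, by simp, fun ht ↦ ?_⟩
        rcases h.1 with h' | h'
        · rw [ht] at h'; exact absurd h' (by decide)
        · exact h'
      · obtain ⟨hle, r', hr', hc⟩ := cond_of_condPosWalk3 rs (j + 1) rest h.2 i c hm'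
        refine ⟨by omega, r', ?_, hc⟩
        rw [show i - j = (i - (j + 1)) + 1 by omega, List.getElem?_cons_succ]
        exact hr'
    · simp only [condPosWalk3, hj, ↓reduceIte] at h
      obtain ⟨hle, r', hr', hc⟩ := cond_of_condPosWalk3 rs (n + 1) ((j, d) :: rest) h i c hm
      refine ⟨by omega, r', ?_, hc⟩
      rw [show i - n = (i - (n + 1)) + 1 by omega, List.getElem?_cons_succ]
      exact hr'

/-- **KERNEL CONDUCTOR WALK (one pass over `rank3Table`)**: every listed certificate that is tame at `2`
certifies its row's conductor `N`. [cite: CremonaAlgorithms1997, Tables] -/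
theorem rank3Table_condPosWalk3 : condPosWalk3 rank3Table 0 rank3RN3Certs = true := by
  decide +kernel

/-- One-pass count of the listed pairs whose certificate is tame at `2` on its row. [folklore] -/
def tameCount3 : List Rank3Row → ℕ → List (ℕ × RNCert3) → ℕ
  | _, _, [] => 0
  | [], _, _ :: _ => 0
  | r :: rs, n, (i, c) :: rest =>
      if i = n then (if c.tame r.intModel then 1 else 0) + tameCount3 rs (n + 1) rest
      else tameCount3 rs (n + 1) ((i, c) :: rest)

/-- **`1116` of the `1550` rows additive at `3` are tame at `2`** (kernel count).
[cite: CremonaAlgorithms1997, Tables] -/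
theorem rank3RN3Certs_tameCount : tameCount3 rank3Table 0 rank3RN3Certs = 1116 := by
  decide +kernel

/-- **A listed row whose certificate is tame at `2` is conductor certified with the place `3`.**
[cite: Rizzo2003, Table II (p. 4), column v(N)] -/
theorem Rank3Row.conductorCertified3_of_mem {i : ℕ} {c : RNCert3} (hm : (i, c) ∈ rank3RN3Certs)
    (hi : i < rank3Table.length) (ht : c.tame (rank3Table[i]'hi).intModel = true) :
    (rank3Table[i]'hi).ConductorCertified3 := by
  obtain ⟨hi', hc, -⟩ := check_of_mem_rn3Certs hm
  obtain ⟨-, r, hr, hN⟩ := cond_of_condPosWalk3 rank3Table 0 rank3RN3Certs rank3Table_condPosWalk3 i c hm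
  rw [Nat.sub_zero, List.getElem?_eq_getElem hi, Option.some.injEq] at hr
  subst hr
  exact ⟨c, hc, ht, hN ht⟩

/-- **`L′(E,1) = 0` over `K = ℚ(√D)` for a listed row tame at `2`, with `hlow`, `hw`, `hmin` AND `hN`
ALL DISCHARGED** (kernel certificates; `hw`, `hN` modulo the named facts `hKD`/`hR` resp. the five
conductor-exponent facts and `h3`): the remaining hypotheses are modularity `hE`,
Gross–Zagier–Kolyvagin over `K` (`hGZKK`), `K` (`hK`, `hdK`) and the twist value `hLD`.
[cite: GrossLMS1991, (1.1) and Thm. 1.3] [cite: Rizzo2003, Table II (p. 4)] -/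
theorem Rank3Row.rank3_lderiv_eq_zero_kernel_wmN3 {i : ℕ} {c : RNCert3} (hm : (i, c) ∈ rank3RN3Certs)
    (hi : i < rank3Table.length) (ht : c.tame (rank3Table[i]'hi).intModel = true)
    (K : Type) [Field K] [NumberField K] (hE : WeierstrassCurve.hasEntireLFunction_rat)
    (hGZKK : mordellWeilRank_eq_one_of_LDerivEK_ne_zero (rank3Table[i]'hi).curve K)
    (h0 : ∀ v : HeightOneSpectrum ℤ, conductorExponent_eq_zero_iff v (rank3Table[i]'hi).curve)
    (h1 : ∀ v : HeightOneSpectrum ℤ, conductorExponent_eq_one_iff v (rank3Table[i]'hi).curve)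
    (h2 : ∀ v : HeightOneSpectrum ℤ, two_le_conductorExponent_iff v (rank3Table[i]'hi).curve)
    (h5 : ∀ v : HeightOneSpectrum ℤ,
      conductorExponent_le_two_of_five_le_natGenerator (rank3Table[i]'hi).curve v)
    (hf : ∀ v : HeightOneSpectrum ℤ, factorization_conductorNorm (rank3Table[i]'hi).curve v)
    (h3 : (rank3Table[i]'hi).curve.conductorExponent_eq_tableConductorExponentThree)
    (hK : IsImaginaryQuadratic K) (hdK : NumberField.discr K = (rank3Table[i]'hi).D)
    (hKD : (rank3Table[i]'hi).curve.rootNumber_eq_neg_finprod_tableLocalRootNumberAt')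
    (hR : (rank3Table[i]'hi).curve.rootNumber_eq_neg_finprod_fullTableLocalRootNumberAt)
    (hLD : ((rank3Table[i]'hi).curve.quadraticTwist ((rank3Table[i]'hi).D : ℚ)).entireLFunction 1 ≠ 0) :
    deriv (rank3Table[i]'hi).curve.entireLFunction 1 = 0 :=
  Rank3Row.rank3_lderiv_eq_zero_kernel_wm (List.getElem_mem hi) K hE hGZKK
    (Rank3Row.conductorNorm_eq_of_certified3 (Rank3Row.conductorCertified3_of_mem hm hi ht)
      h0 h1 h2 h5 hf h3) hK hdK hKD hR hLD

/-- Self-test (kernel): row `30` (`27747c1`, `N = 3² · 3083`) is conductor certified with the place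
`3`. [cite: CremonaAlgorithms1997, Tables] -/
theorem conductorCertified3_row30 :
    (rank3Table[30]'(by rw [rank3Table_length]; norm_num)).ConductorCertified3 :=
  ⟨⟨0, 4, 3, 8, 2, 3, [⟨3083, 55, 1, 1, 1569⟩]⟩, by decide +kernel, by decide +kernel, by decide +kernel⟩

end Summit.BirchSwinnertonDyer.BirchSwinnertonDyer.Rank2Observatory
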